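import Mathlib
import Summits.Ventures.PercRepro2.HCov
import Summits.Ventures.PercRepro2.HCovCubic
import Summits.Ventures.PercRepro2.TriDisagreement
import Summits.Ventures.PercRepro2.TriDisagreementPinned
import Summits.Ventures.PercRepro2.TypedSplit
import Summits.Ventures.PercRepro2.OneTypedEdge
import Summits.Ventures.PercRepro2.StarPattern
import Summits.Ventures.PercRepro2.StarIdentities
import Summits.Ventures.PercRepro2.StarDebt
import Summits.Ventures.PercRepro2.ChainCoeff
import Summits.Ventures.PercRepro2.StarChain

/-!
# The payment principle and triangle-vs-triple at a `(2,2,2)` star (blind cell PercRepro2,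
p1 g12; ASSIGNMENTS v12.30 (9′), LEAD-CCW (c⁗⁗⁗) «the payment principle»)

The multi-state coefficient `chainCoeff` of `ChainCoeff.lean` is defined for an ARBITRARY family
of states `B : Fin (r + 1) → Bool × Bool × Bool` — `IsChain B` is only the hypothesis of the
conjecture `TriCH`. So the ANTICHAIN coefficient `Λ(01; 02; 12)` of the triangle element (three
pairwise non-nested states, one copy each) is the same sum on the family `![01, 02, 12]` with
counts `(1, 1, 1)`: `antiCoeff`; it is the six-ordering base `Bthree 01 02 12`
(`antiCoeff_eq_Bthree`). The EXCLUSIVE NESTED LEAF `E(T; p) = Λ(T; p; ∅)` is `nestLeaf p`, the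
chain `∅ ⊂ p ⊂ T` with counts `(1, 1, 1)`, and it is the difference of two hypergraph bases,
`B(p₁, T₁) − B(T₁)` (`Btwo_eq_Bone_add_nestLeaf`).

The THREE-HYPEREDGE BASE `B(P₁, Q₁, S₁)` (`Bindep3`: three blocks placed independently in one
copy each, 27 placements, blocks in a common copy merging) specialises to the TRIANGLE BASE
`B(△₁) = Bindep3 01 02 12` (`Btriangle`), and

`B(△₁) = B(T₁) + Σ_p E(T; p) + Λ(01; 02; 12)`  (**`Btriangle_eq`**; 27 = 3 + 18 + 6),

so the `(2,2,2)` star reads `N_(2,2,2) = B(T₂) + B(△₁) − B(T₁)` (**`star_222_triangle`**), the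
lead's identity, and the antichain coefficient is `Λ(01; 02; 12) = B(△₁) + 2 B(T₁) − Σ_p B(p₁, T₁)`
(**`antiCoeff_eq_bases`**).

Two named statements (definitions only, as `TriCH`):
* **`TvT`** (triangle-vs-triple): `B(T₁) ≤ B(△₁)`;
* **`Pay222`** (the one-leaf payment): `0 ≤ Λ(01; 02; 12) + max_p E(T; p)` — the five-mark census
  fact (ends = marks); FALSE with an unmarked end (NEG-109) — the target of record is `TwoLargest`
  (`StarDictionary.lean`).

The kernel implications: **`tvT_of_pay222_of_triCH`** (`Pay222 ∧ TriCH ⟹ TvT`: the paying chain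
leaf absorbs the antichain coefficient, the other two are `≥ 0`), **`typedCount_222_nonneg_of_tvT_of_triCH`**,
**`typedCount_222_nonneg_of_pay222_of_triCH`**, and the `(2,2,2)` hard step in the lead's form,
`0 ≤ N_(2,2,2) ↔ B(T₁) ≤ B(T₂) + B(△₁)` (**`typedCount_222_nonneg_iff_triangle`**). No proof of
`Pay222` or `TriCH` is claimed.
NEG-108 (2026-08-24): the identities are unconditional; every positivity Prop is scoped in its
docstring to the one-rung-down objects of GRAPHS / the five-mark base (never typed hypergraphs).
-/

namespace Summit.Ventures.PercRepro2

open CovForm CovForm.OneTyped CovForm.TypedRed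

namespace StarPattern

/-! ## Multi-state coefficients of arbitrary families -/

section Families

variable {V : Type*} {E : Type*} [Fintype E] [DecidableEq E] {R : Type*} [Field R]

/-- **The `(1,1,1)` coefficient of an arbitrary three-state family** (no chain hypothesis): the six
orderings of the three states over the copies. -/
theorem chainCoeff_perm3 (ends : E → Sym2 V) (o a₁ a₂ a₃ b : V) (s₁ s₂ s₃ : E) (F₀ : Finset E)
    (z₀ : Config E) (τ : E → ℕ) (B : Fin 3 → Bool × Bool × Bool) :
    chainCoeff (R := R) ends o a₁ a₂ a₃ b s₁ s₂ s₃ F₀ z₀ τ B ![1, 1, 1] =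
      patCount ends o a₁ a₂ a₃ b s₁ s₂ s₃ F₀ z₀ τ (B 0) (B 1) (B 2) +
      patCount ends o a₁ a₂ a₃ b s₁ s₂ s₃ F₀ z₀ τ (B 0) (B 2) (B 1) +
      patCount ends o a₁ a₂ a₃ b s₁ s₂ s₃ F₀ z₀ τ (B 1) (B 0) (B 2) +
      patCount ends o a₁ a₂ a₃ b s₁ s₂ s₃ F₀ z₀ τ (B 1) (B 2) (B 0) +
      patCount ends o a₁ a₂ a₃ b s₁ s₂ s₃ F₀ z₀ τ (B 2) (B 0) (B 1) +
      patCount ends o a₁ a₂ a₃ b s₁ s₂ s₃ F₀ z₀ τ (B 2) (B 1) (B 0) := by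
  unfold chainCoeff
  rw [assignments_one_one_one]
  rw [Finset.sum_insert (by decide), Finset.sum_insert (by decide), Finset.sum_insert (by decide),
    Finset.sum_insert (by decide), Finset.sum_insert (by decide), Finset.sum_singleton]
  simp only [Matrix.cons_val_zero, Matrix.cons_val_one, Matrix.head_cons, Matrix.cons_val_two,
    Matrix.tail_cons]
  ring

/-- **The antichain (triangle) coefficient** `Λ(01; 02; 12)`: the multi-state element whose three
states are the three pairs of the star, one copy each — `chainCoeff` on the non-nested family
`![01, 02, 12]` with counts `(1, 1, 1)` (`IsChain` is the hypothesis of `TriCH` only). -/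
noncomputable def antiCoeff (ends : E → Sym2 V) (o a₁ a₂ a₃ b : V) (s₁ s₂ s₃ : E) (F₀ : Finset E)
    (z₀ : Config E) (τ : E → ℕ) : R :=
  chainCoeff ends o a₁ a₂ a₃ b s₁ s₂ s₃ F₀ z₀ τ
    ![(true, true, false), (true, false, true), (false, true, true)] ![1, 1, 1]

/-- The antichain coefficient is the six-ordering base `B′(01, 02, 12)`. -/
theorem antiCoeff_eq_Bthree (ends : E → Sym2 V) (o a₁ a₂ a₃ b : V) (s₁ s₂ s₃ : E) (F₀ : Finset E)
    (z₀ : Config E) (τ : E → ℕ) :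
    antiCoeff (R := R) ends o a₁ a₂ a₃ b s₁ s₂ s₃ F₀ z₀ τ =
      Bthree ends o a₁ a₂ a₃ b s₁ s₂ s₃ F₀ z₀ τ (true, true, false) (true, false, true)
        (false, true, true) := by
  unfold antiCoeff
  rw [chainCoeff_perm3]
  unfold Bthree
  simp only [Matrix.cons_val_zero, Matrix.cons_val_one, Matrix.head_cons, Matrix.cons_val_two,
    Matrix.tail_cons]

/-- **The exclusive nested leaf** `E(T; p) = Λ(T; p; ∅)`: the chain `∅ ⊂ p ⊂ T` with counts
`(1, 1, 1)`. -/
noncomputable def nestLeaf (ends : E → Sym2 V) (o a₁ a₂ a₃ b : V) (s₁ s₂ s₃ : E) (F₀ : Finset E)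
    (z₀ : Config E) (τ : E → ℕ) (p : Bool × Bool × Bool) : R :=
  chainCoeff ends o a₁ a₂ a₃ b s₁ s₂ s₃ F₀ z₀ τ ![(false, false, false), p, (true, true, true)]
    ![1, 1, 1]

/-- **The nested leaf is a difference of hypergraph bases**: `B(p₁, T₁) = B(T₁) + E(T; p)` for
every block `p` (the union `p ∪ T = T`). -/
theorem Btwo_eq_Bone_add_nestLeaf (ends : E → Sym2 V) (o a₁ a₂ a₃ b : V) (s₁ s₂ s₃ : E)
    (F₀ : Finset E) (z₀ : Config E) (τ : E → ℕ) (p : Bool × Bool × Bool) :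
    Btwo (R := R) ends o a₁ a₂ a₃ b s₁ s₂ s₃ F₀ z₀ τ p (true, true, true) =
      Bone ends o a₁ a₂ a₃ b s₁ s₂ s₃ F₀ z₀ τ (true, true, true) +
        nestLeaf ends o a₁ a₂ a₃ b s₁ s₂ s₃ F₀ z₀ τ p := by
  unfold nestLeaf
  rw [chainCoeff_one_one_one]
  unfold Btwo Bone
  simp only [orU, Bool.or_true]
  ring

/-- The type-`2` base is the chain `∅ ⊂ P` with counts `(1, 2)`. -/
theorem Btype2_eq_chainCoeff (ends : E → Sym2 V) (o a₁ a₂ a₃ b : V) (s₁ s₂ s₃ : E) (F₀ : Finset E)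
    (z₀ : Config E) (τ : E → ℕ) (P : Bool × Bool × Bool) :
    Btype2 (R := R) ends o a₁ a₂ a₃ b s₁ s₂ s₃ F₀ z₀ τ P =
      chainCoeff ends o a₁ a₂ a₃ b s₁ s₂ s₃ F₀ z₀ τ ![(false, false, false), P] ![1, 2] := by
  rw [chainCoeff_one_two]; unfold Btype2; ring

end Families

/-! ## The three-hyperedge base and the triangle base -/

section Triangle

variable {V : Type*} {E : Type*} [Fintype E] [DecidableEq E] {R : Type*} [Field R]

/-- The block `P` on a copy that carries it (`b = true`), the empty block otherwise. -/
def onCopy (P : Bool × Bool × Bool) (b : Bool) : Bool × Bool × Bool :=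
  (P.1 && b, P.2.1 && b, P.2.2 && b)

/-- **The three-hyperedge base** `B(P₁, Q₁, S₁)`: the blocks `P`, `Q`, `S` each open in exactly one
copy, independently (27 placements; blocks in a common copy merge into their union). -/
noncomputable def Bindep3 (ends : E → Sym2 V) (o a₁ a₂ a₃ b : V) (s₁ s₂ s₃ : E) (F₀ : Finset E)
    (z₀ : Config E) (τ : E → ℕ) (P Q S : Bool × Bool × Bool) : R :=
  ∑ p ∈ placements, ∑ q ∈ placements, ∑ s ∈ placements,
    patCount ends o a₁ a₂ a₃ b s₁ s₂ s₃ F₀ z₀ τ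
      (orU (onCopy P p.1) (orU (onCopy Q q.1) (onCopy S s.1)))
      (orU (onCopy P p.2.1) (orU (onCopy Q q.2.1) (onCopy S s.2.1)))
      (orU (onCopy P p.2.2) (orU (onCopy Q q.2.2) (onCopy S s.2.2)))

/-- **The triangle base** `B(△₁)`: the three pairs `01`, `02`, `12` of the star as independent
type-`1` hyperedges. -/
noncomputable def Btriangle (ends : E → Sym2 V) (o a₁ a₂ a₃ b : V) (s₁ s₂ s₃ : E) (F₀ : Finset E)
    (z₀ : Config E) (τ : E → ℕ) : R :=
  Bindep3 ends o a₁ a₂ a₃ b s₁ s₂ s₃ F₀ z₀ τ (true, true, false) (true, false, true)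
    (false, true, true)

/-- **The triangle base in the chain basis**: `B(△₁) = B(T₁) + Σ_p E(T; p) + Λ(01; 02; 12)` — of the
27 placements, 3 put all three pairs in one copy (`T` there), 18 put exactly two in one copy (`T`
there, the third pair `p` elsewhere: the nested leaf `E(T; p)`, six orderings for each `p`), and 6
put them in three distinct copies (the antichain coefficient). -/
theorem Btriangle_eq (ends : E → Sym2 V) (o a₁ a₂ a₃ b : V) (s₁ s₂ s₃ : E) (F₀ : Finset E)
    (z₀ : Config E) (τ : E → ℕ) :
    Btriangle (R := R) ends o a₁ a₂ a₃ b s₁ s₂ s₃ F₀ z₀ τ =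
      Bone ends o a₁ a₂ a₃ b s₁ s₂ s₃ F₀ z₀ τ (true, true, true) +
      nestLeaf ends o a₁ a₂ a₃ b s₁ s₂ s₃ F₀ z₀ τ (true, true, false) +
      nestLeaf ends o a₁ a₂ a₃ b s₁ s₂ s₃ F₀ z₀ τ (true, false, true) +
      nestLeaf ends o a₁ a₂ a₃ b s₁ s₂ s₃ F₀ z₀ τ (false, true, true) +
      antiCoeff ends o a₁ a₂ a₃ b s₁ s₂ s₃ F₀ z₀ τ := by
  unfold Btriangle Bindep3
  simp only [sum_placements]
  simp only [onCopy, orU, Bool.and_true, Bool.and_false, Bool.or_true, Bool.or_false]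
  unfold nestLeaf antiCoeff
  rw [chainCoeff_one_one_one, chainCoeff_one_one_one, chainCoeff_one_one_one, chainCoeff_perm3]
  unfold Bone
  simp only [Matrix.cons_val_zero, Matrix.cons_val_one, Matrix.head_cons, Matrix.cons_val_two,
    Matrix.tail_cons]
  ring

/-- **The antichain coefficient in hypergraph bases** (the lead's `L`):
`Λ(01; 02; 12) = B(△₁) + 2 B(T₁) − Σ_p B(p₁, T₁)`. -/
theorem antiCoeff_eq_bases (ends : E → Sym2 V) (o a₁ a₂ a₃ b : V) (s₁ s₂ s₃ : E) (F₀ : Finset E)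
    (z₀ : Config E) (τ : E → ℕ) :
    antiCoeff (R := R) ends o a₁ a₂ a₃ b s₁ s₂ s₃ F₀ z₀ τ =
      Btriangle ends o a₁ a₂ a₃ b s₁ s₂ s₃ F₀ z₀ τ +
        2 * Bone ends o a₁ a₂ a₃ b s₁ s₂ s₃ F₀ z₀ τ (true, true, true) -
        (Btwo ends o a₁ a₂ a₃ b s₁ s₂ s₃ F₀ z₀ τ (true, true, false) (true, true, true) +
          Btwo ends o a₁ a₂ a₃ b s₁ s₂ s₃ F₀ z₀ τ (true, false, true) (true, true, true) +
          Btwo ends o a₁ a₂ a₃ b s₁ s₂ s₃ F₀ z₀ τ (false, true, true) (true, true, true)) := by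
  rw [Btriangle_eq, Btwo_eq_Bone_add_nestLeaf, Btwo_eq_Bone_add_nestLeaf,
    Btwo_eq_Bone_add_nestLeaf]
  ring

variable {ends : E → Sym2 V} {o a₁ a₂ a₃ b : V} {s₁ s₂ s₃ : E} {y u₁ u₂ u₃ : V}

/-- **The `(2,2,2)` star in the lead's form**: `N_(2,2,2) = B(T₂) + B(△₁) − B(T₁)`. -/
theorem star_222_triangle (F : Finset E) (z : Config E) (τ : E → ℕ)
    (D : StarData ends o a₁ a₂ a₃ b s₁ s₂ s₃ y u₁ u₂ u₃ (((F.erase s₁).erase s₂).erase s₃)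
      (Function.update (Function.update (Function.update z s₁ false) s₂ false) s₃ false))
    (hs₁ : s₁ ∈ F) (hs₂ : s₂ ∈ F) (hs₃ : s₃ ∈ F) (hτ₁ : τ s₁ = 2) (hτ₂ : τ s₂ = 2)
    (hτ₃ : τ s₃ = 2) :
    typedCount F z τ (K3 ends o a₁ a₂ a₃ b : Config E → Config E → Config E → R) =
      Btype2 ends o a₁ a₂ a₃ b s₁ s₂ s₃ (((F.erase s₁).erase s₂).erase s₃)
        (Function.update (Function.update (Function.update z s₁ false) s₂ false) s₃ false) τ
        (true, true, true) +
      Btriangle ends o a₁ a₂ a₃ b s₁ s₂ s₃ (((F.erase s₁).erase s₂).erase s₃)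
        (Function.update (Function.update (Function.update z s₁ false) s₂ false) s₃ false) τ -
      Bone ends o a₁ a₂ a₃ b s₁ s₂ s₃ (((F.erase s₁).erase s₂).erase s₃)
        (Function.update (Function.update (Function.update z s₁ false) s₂ false) s₃ false) τ
        (true, true, true) := by
  rw [star_222_chain F z τ D hs₁ hs₂ hs₃ hτ₁ hτ₂ hτ₃, Btriangle_eq, ← antiCoeff_eq_Bthree,
    Btype2_eq_chainCoeff]
  unfold nestLeaf
  ring

/-- **The `(2,2,2)` star in the chain basis, with the antichain coefficient named**:
`N_(2,2,2) = B(T₂) + Σ_p E(T; p) + Λ(01; 02; 12)`. -/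
theorem star_222_leaves (F : Finset E) (z : Config E) (τ : E → ℕ)
    (D : StarData ends o a₁ a₂ a₃ b s₁ s₂ s₃ y u₁ u₂ u₃ (((F.erase s₁).erase s₂).erase s₃)
      (Function.update (Function.update (Function.update z s₁ false) s₂ false) s₃ false))
    (hs₁ : s₁ ∈ F) (hs₂ : s₂ ∈ F) (hs₃ : s₃ ∈ F) (hτ₁ : τ s₁ = 2) (hτ₂ : τ s₂ = 2)
    (hτ₃ : τ s₃ = 2) :
    typedCount F z τ (K3 ends o a₁ a₂ a₃ b : Config E → Config E → Config E → R) =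
      Btype2 ends o a₁ a₂ a₃ b s₁ s₂ s₃ (((F.erase s₁).erase s₂).erase s₃)
        (Function.update (Function.update (Function.update z s₁ false) s₂ false) s₃ false) τ
        (true, true, true) +
      nestLeaf ends o a₁ a₂ a₃ b s₁ s₂ s₃ (((F.erase s₁).erase s₂).erase s₃)
        (Function.update (Function.update (Function.update z s₁ false) s₂ false) s₃ false) τ
        (true, true, false) +
      nestLeaf ends o a₁ a₂ a₃ b s₁ s₂ s₃ (((F.erase s₁).erase s₂).erase s₃)
        (Function.update (Function.update (Function.update z s₁ false) s₂ false) s₃ false) τ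
        (true, false, true) +
      nestLeaf ends o a₁ a₂ a₃ b s₁ s₂ s₃ (((F.erase s₁).erase s₂).erase s₃)
        (Function.update (Function.update (Function.update z s₁ false) s₂ false) s₃ false) τ
        (false, true, true) +
      antiCoeff ends o a₁ a₂ a₃ b s₁ s₂ s₃ (((F.erase s₁).erase s₂).erase s₃)
        (Function.update (Function.update (Function.update z s₁ false) s₂ false) s₃ false) τ := by
  rw [star_222_triangle F z τ D hs₁ hs₂ hs₃ hτ₁ hτ₂ hτ₃, Btriangle_eq]
  ring

end Triangle

/-! ## The two named statements and the kernel implications -/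

section Statements

variable {V : Type*} {E : Type*} [Fintype E] [DecidableEq E] {R : Type*} [Field R] [LinearOrder R]

/-- **TvT (triangle-vs-triple)**: refining the type-`1` triple `T` into its three type-`1` pairs
never lowers the base, `B(T₁) ≤ B(△₁)`. A definition only.
SCOPE (NEG-108): conjectured for the one-rung-down objects of GRAPHS — `(F₀, z₀, τ)` the typed
edges of `G − y`, `G` a finite graph (unmarked vertices allowed), the blocks the pieces of THIS star —
and for the five-mark base; NOT for typed hypergraphs with unmarked vertices (`H*`: `N = −2`). -/
def TvT (ends : E → Sym2 V) (o a₁ a₂ a₃ b : V) (s₁ s₂ s₃ : E) (F₀ : Finset E) (z₀ : Config E)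
    (τ : E → ℕ) : Prop :=
  Bone (R := R) ends o a₁ a₂ a₃ b s₁ s₂ s₃ F₀ z₀ τ (true, true, true) ≤
    Btriangle ends o a₁ a₂ a₃ b s₁ s₂ s₃ F₀ z₀ τ

/-- **The one-leaf payment PAY222** (LEAD-CCW (c⁗⁗⁗)): the antichain coefficient of the triangle
element plus the largest of its three chain leaves is nonnegative, `0 ≤ Λ(01; 02; 12) + max_p E(T; p)`.
A definition only, naming the FIVE-MARK CENSUS FACT (ends of the star = marks; exhaustive ≤ 3
hyperedges, 0 failures): it is FALSE when an end of the star is unmarked (NEG-109, 2026-08-24: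
`A = −4`, `E = (0, 2, 2)`). The payment target of record is `TwoLargest` (`StarDictionary.lean`);
the implications below from `Pay222` hold wherever it holds. -/
def Pay222 (ends : E → Sym2 V) (o a₁ a₂ a₃ b : V) (s₁ s₂ s₃ : E) (F₀ : Finset E) (z₀ : Config E)
    (τ : E → ℕ) : Prop :=
  0 ≤ antiCoeff (R := R) ends o a₁ a₂ a₃ b s₁ s₂ s₃ F₀ z₀ τ +
    max (nestLeaf ends o a₁ a₂ a₃ b s₁ s₂ s₃ F₀ z₀ τ (true, true, false))
      (max (nestLeaf ends o a₁ a₂ a₃ b s₁ s₂ s₃ F₀ z₀ τ (true, false, true))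
        (nestLeaf ends o a₁ a₂ a₃ b s₁ s₂ s₃ F₀ z₀ τ (false, true, true)))

variable [IsStrictOrderedRing R]

/-- `Pay222` in existential form: some pair `p ⊂ T` pays, `0 ≤ Λ(01; 02; 12) + E(T; p)`. -/
theorem pay222_iff_exists (ends : E → Sym2 V) (o a₁ a₂ a₃ b : V) (s₁ s₂ s₃ : E) (F₀ : Finset E)
    (z₀ : Config E) (τ : E → ℕ) :
    Pay222 (R := R) ends o a₁ a₂ a₃ b s₁ s₂ s₃ F₀ z₀ τ ↔
      ∃ p ∈ placements2, 0 ≤ antiCoeff (R := R) ends o a₁ a₂ a₃ b s₁ s₂ s₃ F₀ z₀ τ +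
        nestLeaf ends o a₁ a₂ a₃ b s₁ s₂ s₃ F₀ z₀ τ p := by
  unfold Pay222
  constructor
  · intro h
    rcases max_choice (nestLeaf (R := R) ends o a₁ a₂ a₃ b s₁ s₂ s₃ F₀ z₀ τ (true, true, false))
      (max (nestLeaf ends o a₁ a₂ a₃ b s₁ s₂ s₃ F₀ z₀ τ (true, false, true))
        (nestLeaf ends o a₁ a₂ a₃ b s₁ s₂ s₃ F₀ z₀ τ (false, true, true))) with h1 | h1
    · exact ⟨(true, true, false), by simp [placements2], by rw [h1] at h; exact h⟩
    · rcases max_choice (nestLeaf (R := R) ends o a₁ a₂ a₃ b s₁ s₂ s₃ F₀ z₀ τ (true, false, true))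
        (nestLeaf ends o a₁ a₂ a₃ b s₁ s₂ s₃ F₀ z₀ τ (false, true, true)) with h2 | h2
      · exact ⟨(true, false, true), by simp [placements2], by rw [h1, h2] at h; exact h⟩
      · exact ⟨(false, true, true), by simp [placements2], by rw [h1, h2] at h; exact h⟩
  · rintro ⟨p, hp, h⟩
    simp only [placements2, Finset.mem_insert, Finset.mem_singleton] at hp
    have h1 := le_max_left (nestLeaf (R := R) ends o a₁ a₂ a₃ b s₁ s₂ s₃ F₀ z₀ τ (true, true, false))
      (max (nestLeaf ends o a₁ a₂ a₃ b s₁ s₂ s₃ F₀ z₀ τ (true, false, true))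
        (nestLeaf ends o a₁ a₂ a₃ b s₁ s₂ s₃ F₀ z₀ τ (false, true, true)))
    have h2 := le_max_right (nestLeaf (R := R) ends o a₁ a₂ a₃ b s₁ s₂ s₃ F₀ z₀ τ (true, true, false))
      (max (nestLeaf ends o a₁ a₂ a₃ b s₁ s₂ s₃ F₀ z₀ τ (true, false, true))
        (nestLeaf ends o a₁ a₂ a₃ b s₁ s₂ s₃ F₀ z₀ τ (false, true, true)))
    have h3 := le_max_left (nestLeaf (R := R) ends o a₁ a₂ a₃ b s₁ s₂ s₃ F₀ z₀ τ (true, false, true))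
      (nestLeaf ends o a₁ a₂ a₃ b s₁ s₂ s₃ F₀ z₀ τ (false, true, true))
    have h4 := le_max_right (nestLeaf (R := R) ends o a₁ a₂ a₃ b s₁ s₂ s₃ F₀ z₀ τ (true, false, true))
      (nestLeaf ends o a₁ a₂ a₃ b s₁ s₂ s₃ F₀ z₀ τ (false, true, true))
    rcases hp with rfl | rfl | rfl <;> linarith

omit [IsStrictOrderedRing R] in
/-- **Under 2′TRI-CH the nested leaves are nonnegative**: `0 ≤ E(T; p)` for `p ∈ {01, 02, 12}`. -/
theorem nestLeaf_nonneg_of_triCH (ends : E → Sym2 V) (o a₁ a₂ a₃ b : V) (s₁ s₂ s₃ : E)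
    (F₀ : Finset E) (z₀ : Config E) (τ : E → ℕ)
    (hCH : TriCH (R := R) ends o a₁ a₂ a₃ b s₁ s₂ s₃ F₀ z₀ τ) :
    0 ≤ nestLeaf (R := R) ends o a₁ a₂ a₃ b s₁ s₂ s₃ F₀ z₀ τ (true, true, false) ∧
    0 ≤ nestLeaf (R := R) ends o a₁ a₂ a₃ b s₁ s₂ s₃ F₀ z₀ τ (true, false, true) ∧
    0 ≤ nestLeaf (R := R) ends o a₁ a₂ a₃ b s₁ s₂ s₃ F₀ z₀ τ (false, true, true) :=
  ⟨hCH 2 _ isChain_01_T ![1, 1, 1] (by decide), hCH 2 _ isChain_02_T ![1, 1, 1] (by decide),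
    hCH 2 _ isChain_12_T ![1, 1, 1] (by decide)⟩

omit [IsStrictOrderedRing R] in
/-- **Under 2′TRI-CH the type-`2` base of the triple is nonnegative**: `0 ≤ B(T₂)`. -/
theorem Btype2_T_nonneg_of_triCH (ends : E → Sym2 V) (o a₁ a₂ a₃ b : V) (s₁ s₂ s₃ : E)
    (F₀ : Finset E) (z₀ : Config E) (τ : E → ℕ)
    (hCH : TriCH (R := R) ends o a₁ a₂ a₃ b s₁ s₂ s₃ F₀ z₀ τ) :
    0 ≤ Btype2 (R := R) ends o a₁ a₂ a₃ b s₁ s₂ s₃ F₀ z₀ τ (true, true, true) := by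
  rw [Btype2_eq_chainCoeff]
  exact hCH 1 _ isChain_T ![1, 2] (by decide)

/-- **TvT from the payment principle and chain positivity**: `Pay222 ∧ TriCH ⟹ TvT` — since
`B(△₁) − B(T₁) = Σ_p E(T; p) + Λ(01; 02; 12)`, the paying chain leaf absorbs the antichain
coefficient and the other two chain leaves are `≥ 0`. -/
theorem tvT_of_pay222_of_triCH (ends : E → Sym2 V) (o a₁ a₂ a₃ b : V) (s₁ s₂ s₃ : E)
    (F₀ : Finset E) (z₀ : Config E) (τ : E → ℕ)
    (hP : Pay222 (R := R) ends o a₁ a₂ a₃ b s₁ s₂ s₃ F₀ z₀ τ)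
    (hCH : TriCH (R := R) ends o a₁ a₂ a₃ b s₁ s₂ s₃ F₀ z₀ τ) :
    TvT (R := R) ends o a₁ a₂ a₃ b s₁ s₂ s₃ F₀ z₀ τ := by
  unfold TvT
  rw [Btriangle_eq]
  obtain ⟨h1, h2, h3⟩ := nestLeaf_nonneg_of_triCH ends o a₁ a₂ a₃ b s₁ s₂ s₃ F₀ z₀ τ hCH
  rcases (pay222_iff_exists ends o a₁ a₂ a₃ b s₁ s₂ s₃ F₀ z₀ τ).1 hP with ⟨p, hp, h⟩
  simp only [placements2, Finset.mem_insert, Finset.mem_singleton] at hp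
  rcases hp with rfl | rfl | rfl <;> linarith

variable {ends : E → Sym2 V} {o a₁ a₂ a₃ b : V} {s₁ s₂ s₃ : E} {y u₁ u₂ u₃ : V}

/-- **The `(2,2,2)` hard step in the lead's form**: `0 ≤ N_(2,2,2) ↔ B(T₁) ≤ B(T₂) + B(△₁)`. -/
theorem typedCount_222_nonneg_iff_triangle (F : Finset E) (z : Config E) (τ : E → ℕ)
    (D : StarData ends o a₁ a₂ a₃ b s₁ s₂ s₃ y u₁ u₂ u₃ (((F.erase s₁).erase s₂).erase s₃)
      (Function.update (Function.update (Function.update z s₁ false) s₂ false) s₃ false))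
    (hs₁ : s₁ ∈ F) (hs₂ : s₂ ∈ F) (hs₃ : s₃ ∈ F) (hτ₁ : τ s₁ = 2) (hτ₂ : τ s₂ = 2)
    (hτ₃ : τ s₃ = 2) :
    0 ≤ typedCount F z τ (K3 ends o a₁ a₂ a₃ b : Config E → Config E → Config E → R) ↔
      Bone (R := R) ends o a₁ a₂ a₃ b s₁ s₂ s₃ (((F.erase s₁).erase s₂).erase s₃)
        (Function.update (Function.update (Function.update z s₁ false) s₂ false) s₃ false) τ
        (true, true, true) ≤
      Btype2 ends o a₁ a₂ a₃ b s₁ s₂ s₃ (((F.erase s₁).erase s₂).erase s₃)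
        (Function.update (Function.update (Function.update z s₁ false) s₂ false) s₃ false) τ
        (true, true, true) +
      Btriangle ends o a₁ a₂ a₃ b s₁ s₂ s₃ (((F.erase s₁).erase s₂).erase s₃)
        (Function.update (Function.update (Function.update z s₁ false) s₂ false) s₃ false) τ := by
  rw [star_222_triangle F z τ D hs₁ hs₂ hs₃ hτ₁ hτ₂ hτ₃]
  constructor
  · intro h; linarith
  · intro h; linarith

/-- **Under TvT and 2′TRI-CH the `(2,2,2)` star is nonnegative**: `N_(2,2,2) = B(T₂) + (B(△₁) −
B(T₁)) ≥ 0`. -/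
theorem typedCount_222_nonneg_of_tvT_of_triCH (F : Finset E) (z : Config E) (τ : E → ℕ)
    (D : StarData ends o a₁ a₂ a₃ b s₁ s₂ s₃ y u₁ u₂ u₃ (((F.erase s₁).erase s₂).erase s₃)
      (Function.update (Function.update (Function.update z s₁ false) s₂ false) s₃ false))
    (hs₁ : s₁ ∈ F) (hs₂ : s₂ ∈ F) (hs₃ : s₃ ∈ F) (hτ₁ : τ s₁ = 2) (hτ₂ : τ s₂ = 2)
    (hτ₃ : τ s₃ = 2)
    (hT : TvT (R := R) ends o a₁ a₂ a₃ b s₁ s₂ s₃ (((F.erase s₁).erase s₂).erase s₃)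
      (Function.update (Function.update (Function.update z s₁ false) s₂ false) s₃ false) τ)
    (hCH : TriCH (R := R) ends o a₁ a₂ a₃ b s₁ s₂ s₃ (((F.erase s₁).erase s₂).erase s₃)
      (Function.update (Function.update (Function.update z s₁ false) s₂ false) s₃ false) τ) :
    0 ≤ typedCount F z τ (K3 ends o a₁ a₂ a₃ b : Config E → Config E → Config E → R) := by
  rw [typedCount_222_nonneg_iff_triangle F z τ D hs₁ hs₂ hs₃ hτ₁ hτ₂ hτ₃]
  unfold TvT at hT
  have h2 := Btype2_T_nonneg_of_triCH (R := R) ends o a₁ a₂ a₃ b s₁ s₂ s₃ _ _ τ hCH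
  linarith

/-- **The lead's chain in the kernel**: `Pay222 ∧ TriCH` (one rung down) `⟹ 0 ≤ N_(2,2,2)`. -/
theorem typedCount_222_nonneg_of_pay222_of_triCH (F : Finset E) (z : Config E) (τ : E → ℕ)
    (D : StarData ends o a₁ a₂ a₃ b s₁ s₂ s₃ y u₁ u₂ u₃ (((F.erase s₁).erase s₂).erase s₃)
      (Function.update (Function.update (Function.update z s₁ false) s₂ false) s₃ false))
    (hs₁ : s₁ ∈ F) (hs₂ : s₂ ∈ F) (hs₃ : s₃ ∈ F) (hτ₁ : τ s₁ = 2) (hτ₂ : τ s₂ = 2)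
    (hτ₃ : τ s₃ = 2)
    (hP : Pay222 (R := R) ends o a₁ a₂ a₃ b s₁ s₂ s₃ (((F.erase s₁).erase s₂).erase s₃)
      (Function.update (Function.update (Function.update z s₁ false) s₂ false) s₃ false) τ)
    (hCH : TriCH (R := R) ends o a₁ a₂ a₃ b s₁ s₂ s₃ (((F.erase s₁).erase s₂).erase s₃)
      (Function.update (Function.update (Function.update z s₁ false) s₂ false) s₃ false) τ) :
    0 ≤ typedCount F z τ (K3 ends o a₁ a₂ a₃ b : Config E → Config E → Config E → R) :=
  typedCount_222_nonneg_of_tvT_of_triCH F z τ D hs₁ hs₂ hs₃ hτ₁ hτ₂ hτ₃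
    (tvT_of_pay222_of_triCH ends o a₁ a₂ a₃ b s₁ s₂ s₃ _ _ τ hP hCH) hCH

end Statements

end StarPattern

end Summit.Ventures.PercRepro2
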